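import Literature.Combinatorics.Enumerative.MultivariateAperyGZeroProofs
import Mathlib.Tactic
import HarnessLib

/-!
# Straub 2014, (25) for general `r`, part 1: `G₀ ≡ 0 (mod p^{3r})` for λ = (2,1) (Apéry's `ζ(2)` family `B(𝐧)`)

Topic `Literature/Combinatorics/Enumerative`, namespace `Literature.Combinatorics.Enumerative.MultivariateAperyPrimePowerProofs`
(sequel of `MultivariateAperyGZeroProofs`, whose machinery — `block_sum_weights`, `sum_range_blocks`,
`mul_choose_sub_one`, `sub_one_div_eq`, and `lemma55` of `MultivariateAperyDigitReductionProofs` — it reuses;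
feeds `MultivariateAperyPrimePowerBProofs`). PROOF FILE: sorry-free theorems only — no definition, no named
fact. Source read on the page (held `paper:arxiv-1401.0854`): A. Straub, *Multivariate Apéry numbers and
supercongruences of rational functions*, Algebra & Number Theory **8** (2014) [Straub2014], Example 3.4:
«for `𝐧 ∈ ℤ³` and integers `r ≥ 1`, the supercongruences (25) `B(p^r 𝐧) ≡ B(p^{r−1} 𝐧) (mod p^{3r})` hold for
all primes `p ≥ 5`. In the diagonal case `n₁ = n₂ = n₃`, this result was first proved by Coster» — Theorem 3.2
(22) for `λ = (2,1)`, `ε = 1`, whose proof is the proof of Theorem 1.2 («Our proof of Theorem 1.2, which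
generalizes the supercongruence in Theorem 3.2»). This file is the λ = (2,1) copy of `MultivariateAperyGZeroProofs`
(three factors `C(m₁, k) C(m₁+m₂−k, m₁) C(m₃, k)` — the order of the tree's `straubB` — instead of four).
HONEST FRAMING (cell pub-zeta5): classical congruences for Apéry-type numbers; nothing about `ζ(5)`.

* `companionB_modEq` — `C(p^r 𝐧; k) ≡ C(p^{r−1} 𝐧; [k/p]) (mod p^r)` for
  `C(𝐦; k) = C(m₁−1, k) C(m₁+m₂−k−1, m₁) C(m₃−1, k)` (tree `lemma54` twice, `lemma55` once);
* `sq_mul_termB_eq` — `k² A(𝐦; k) = m₁ m₃ B(𝐦; k)`; `pow_dvd_sum_weights_companionB` — (46);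
  **`pow_dvd_sum_not_dvd_termB`** — `p^{3r} ∣ G₀(p^r 𝐧)`, λ = (2,1).
[cite: Straub2014, Example 3.4 (25), Theorem 3.2 (22), Theorem 1.2 (proof)]
-/

open Finset

namespace Literature.Combinatorics.Enumerative.MultivariateAperyPrimePowerProofs

open MultivariateAperyNumbers (lemma54 sum_block_dvd block)

section GZeroB

variable {p : ℕ} [hp : Fact p.Prime]

omit hp in
/-- **The companion product reduces digitwise, λ = (2,1)**: with `C(𝐦; k) = C(m₁−1, k) C(m₁+m₂−k−1, m₁) C(m₃−1, k)`,
`C(p^r 𝐧; k) ≡ C(p^{r−1} 𝐧; [k/p]) (mod p^r)` for a prime `p`, `r ≥ 1`, `n₁, n₃ ≥ 1`, all `k`.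
[cite: Straub2014, Theorem 3.2 (22) (proof = proof of Theorem 1.2) with Lemmas 5.4, 5.5] -/
theorem companionB_modEq (hpr : p.Prime) {r : ℕ} (hr : 1 ≤ r) {n₁ n₃ : ℕ} (hn₁ : 1 ≤ n₁) (hn₃ : 1 ≤ n₃)
    (n₂ k : ℕ) :
    (((p ^ r * n₁ - 1).choose k * (p ^ r * n₁ + p ^ r * n₂ - k - 1).choose (p ^ r * n₁) *
        (p ^ r * n₃ - 1).choose k : ℕ) : ℤ) ≡
      (((p ^ (r - 1) * n₁ - 1).choose (k / p) * (p ^ (r - 1) * n₁ + p ^ (r - 1) * n₂ - k / p - 1).choose (p ^ (r - 1) * n₁) *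
        (p ^ (r - 1) * n₃ - 1).choose (k / p) : ℕ) : ℤ) [ZMOD (p : ℤ) ^ r] := by
  have h1 := lemma54 hpr hr hn₁ k
  have h3 := lemma54 hpr hr hn₃ k
  have h13 := h1.mul h3
  have e : ∀ (n : ℕ) (a b : ℤ), (-1) ^ n * a * ((-1) ^ n * b) = a * b := fun n a b => by
    rw [show (-1 : ℤ) ^ n * a * ((-1) ^ n * b) = ((-1) ^ n) ^ 2 * (a * b) by ring, ← pow_mul, mul_comm n 2,
      pow_mul]
    norm_num
  rw [e, e] at h13
  have h2 := lemma55 hpr hr n₁ n₂ k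
  have := h13.mul h2
  push_cast at this ⊢
  have eq1 : ∀ a b c : ℤ, a * c * b = a * b * c := fun a b c => by ring
  rw [eq1, eq1 (((p ^ (r - 1) * n₁ - 1).choose (k / p) : ℕ) : ℤ)] at this
  exact this

/-- `k² · A(𝐦; k) = m₁ m₃ · C(m₁−1, k−1) C(m₁+m₂−k, m₁) C(m₃−1, k−1)` for λ = (2,1), `k ≥ 1`.
[cite: Straub2014, Theorem 1.2 (proof, «B_λ(𝐧; k) = k²/(n₁ n_{1+λ₁}) A_λ(𝐧; k) are integers»)] -/
theorem sq_mul_termB_eq {m₁ m₂ m₃ k : ℕ} (hk : 1 ≤ k) :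
    k ^ 2 * (m₁.choose k * (m₁ + m₂ - k).choose m₁ * m₃.choose k) =
      m₁ * m₃ * ((m₁ - 1).choose (k - 1) * (m₁ + m₂ - k).choose m₁ * (m₃ - 1).choose (k - 1)) := by
  have h1 := mul_choose_sub_one (m := m₁) hk
  have h3 := mul_choose_sub_one (m := m₃) hk
  calc k ^ 2 * (m₁.choose k * (m₁ + m₂ - k).choose m₁ * m₃.choose k)
      = (m₁.choose k * k) * (m₃.choose k * k) * (m₁ + m₂ - k).choose m₁ := by ring
    _ = (m₁ * (m₁ - 1).choose (k - 1)) * (m₃ * (m₃ - 1).choose (k - 1)) * (m₁ + m₂ - k).choose m₁ := by rw [h1, h3]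
    _ = _ := by ring

omit hp in
/-- A natural number is a unit of `ℤ_p` iff it is prime to `p`. [folklore] -/
private theorem isUnit_natCast_padicInt_iff' [Fact p.Prime] (K : ℕ) : IsUnit ((K : ℤ_[p])) ↔ ¬ p ∣ K := by
  rw [PadicInt.isUnit_iff, ← PadicInt.norm_natCast_lt_one_iff (p := p)]
  have := PadicInt.norm_le_one ((K : ℤ_[p]))
  constructor
  · intro h; rw [h]; exact lt_irrefl 1
  · intro h; exact le_antisymm this (not_lt.mp h)

/-- `Ring.inverse k · k = 1` in `ℤ_p` for `p ∤ k`. [folklore] -/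
private theorem ringInverse_natCast_mul_self' {K : ℕ} (hK : ¬ p ∣ K) :
    Ring.inverse ((K : ℤ_[p])) * (K : ℤ_[p]) = 1 :=
  Ring.inverse_mul_cancel _ ((isUnit_natCast_padicInt_iff' K).mpr hK)

/-- `Ring.inverse k = 0` in `ℤ_p` for `p ∣ k`. [folklore] -/
private theorem ringInverse_natCast_of_dvd' {K : ℕ} (hK : p ∣ K) : Ring.inverse ((K : ℤ_[p])) = 0 :=
  Ring.inverse_non_unit _ (fun h => (isUnit_natCast_padicInt_iff' K).mp h hK)

/-- `p^r` divides the weighted companion sum `Σ_{0 ≤ k < n₁ p^r} a_k C(p^r 𝐧; k)` in `ℤ_p`, λ = (2,1)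
(`p ≥ 5`, `n₁, n₃ ≥ 1`). [cite: Straub2014, Theorem 1.2 (proof, (46)) and Theorem 3.2 (22)] -/
theorem pow_dvd_sum_weights_companionB (h5 : 5 ≤ p) (r : ℕ) {n₁ n₃ : ℕ} (hn₁ : 1 ≤ n₁)
    (hn₃ : 1 ≤ n₃) (n₂ : ℕ) :
    (p : ℤ_[p]) ^ r ∣ ∑ k ∈ range (n₁ * p ^ r),
      (Ring.inverse ((k : ℤ_[p]))) ^ 2 *
        (((p ^ r * n₁ - 1).choose k * (p ^ r * n₁ + p ^ r * n₂ - k - 1).choose (p ^ r * n₁) *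
          (p ^ r * n₃ - 1).choose k : ℕ) : ℤ_[p]) := by
  have hp' := hp.out
  have hp0 : 0 < p := hp'.pos
  set Cf : ℕ → ℤ → ℤ_[p] := fun ρ k => if 0 ≤ k then
      (((p ^ ρ * n₁ - 1).choose k.toNat * (p ^ ρ * n₁ + p ^ ρ * n₂ - k.toNat - 1).choose (p ^ ρ * n₁) *
        (p ^ ρ * n₃ - 1).choose k.toNat : ℕ) : ℤ_[p]) else 0 with hCf
  set a : ℤ → ℤ_[p] := fun k => if 0 < k then (Ring.inverse (((k.toNat : ℕ) : ℤ_[p]))) ^ 2 else 0 with ha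
  have hC : ∀ ρ : ℕ, 1 ≤ ρ → ∀ k : ℤ, (p : ℤ_[p]) ^ ρ ∣ Cf ρ k - Cf (ρ - 1) (k / p) := by
    intro ρ hρ k
    rcases lt_or_ge k 0 with hk | hk
    · have hkp : k / (p : ℤ) < 0 := Int.ediv_neg_of_neg_of_pos hk (by exact_mod_cast hp0)
      simp only [hCf, if_neg (not_le.mpr hk), if_neg (not_le.mpr hkp), sub_zero]
      exact dvd_zero _
    · obtain ⟨j, rfl⟩ := Int.eq_ofNat_of_zero_le hk
      have hjp : ((j : ℤ) / (p : ℤ)) = ((j / p : ℕ) : ℤ) := (Int.natCast_div j p).symm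
      simp only [hCf, if_pos hk, hjp, if_pos (Int.natCast_nonneg _), Int.toNat_natCast]
      obtain ⟨c, hc⟩ := (Int.ModEq.dvd ((companionB_modEq hp' hρ hn₁ hn₃ n₂ j).symm))
      refine ⟨(c : ℤ_[p]), ?_⟩
      have := congrArg (Int.cast : ℤ → ℤ_[p]) hc
      push_cast at this
      rw [← this]
      push_cast
      ring
  have hblocks := sum_block_dvd (R := ℤ_[p]) hp0
    (fun x hx => (mul_eq_zero.mp hx).resolve_left (by exact_mod_cast hp'.ne_zero)) Cf hC r a
    (block_sum_weights (p := p) h5)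
  have hsum : (p : ℤ_[p]) ^ r ∣ ∑ l ∈ range n₁, ∑ k ∈ block p (l : ℤ) r, a k * Cf r k :=
    Finset.dvd_sum fun l _ => hblocks l
  rw [sum_range_blocks hp0 r (fun k => a k * Cf r k) n₁] at hsum
  have heq : ∑ k ∈ range (n₁ * p ^ r), a (k : ℤ) * Cf r (k : ℤ) = ∑ k ∈ range (n₁ * p ^ r),
      (Ring.inverse ((k : ℤ_[p]))) ^ 2 *
        (((p ^ r * n₁ - 1).choose k * (p ^ r * n₁ + p ^ r * n₂ - k - 1).choose (p ^ r * n₁) *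
          (p ^ r * n₃ - 1).choose k : ℕ) : ℤ_[p]) := by
    refine Finset.sum_congr rfl fun k _ => ?_
    simp only [ha, hCf, Int.natCast_pos, if_pos (Int.natCast_nonneg k), Int.toNat_natCast]
    rcases Nat.eq_zero_or_pos k with h0 | hk
    · subst h0
      simp
    · rw [if_pos hk]
  rwa [heq] at hsum

/-- **`G₀(p^r 𝐧) ≡ 0 (mod p^{3r})` for λ = (2,1)** (`p ≥ 5`, `r ≥ 1`, `𝐧 ∈ ℤ_{≥0}^3`):
`p^{3r} ∣ Σ_{0 ≤ k ≤ p^r n₁, p∤k} C(p^r n₁, k) C(p^r n₁ + p^r n₂ − k, p^r n₁) C(p^r n₃, k)`.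
[cite: Straub2014, Theorem 1.2 (proof, (46)) and Theorem 3.2 (22), Example 3.4 (25)] -/
theorem pow_dvd_sum_not_dvd_termB (h5 : 5 ≤ p) {r : ℕ} (hr : 1 ≤ r) (n₁ n₂ n₃ : ℕ) :
    (p : ℤ) ^ (3 * r) ∣ ∑ k ∈ range (p ^ r * n₁ + 1),
      (if p ∣ k then 0 else
        (((p ^ r * n₁).choose k * (p ^ r * n₁ + p ^ r * n₂ - k).choose (p ^ r * n₁) * (p ^ r * n₃).choose k : ℕ) : ℤ)) := by
  have hp' := hp.out
  have hp0 : 0 < p := hp'.pos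
  have hdeg : n₁ = 0 ∨ n₃ = 0 → ∀ k ∈ range (p ^ r * n₁ + 1),
      (if p ∣ k then (0 : ℤ) else
        (((p ^ r * n₁).choose k * (p ^ r * n₁ + p ^ r * n₂ - k).choose (p ^ r * n₁) * (p ^ r * n₃).choose k : ℕ) : ℤ)) = 0 := by
    intro hn k _
    split_ifs with hk
    · rfl
    · have hk1 : 1 ≤ k := Nat.one_le_iff_ne_zero.mpr fun h => hk (h ▸ dvd_zero p)
      rcases hn with h | h <;> subst h <;>
        simp [Nat.choose_eq_zero_of_lt (show 0 < k from hk1)]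
  rcases Nat.eq_zero_or_pos n₁ with h0 | hn₁
  · rw [Finset.sum_eq_zero (hdeg (Or.inl h0))]; exact dvd_zero _
  rcases Nat.eq_zero_or_pos n₃ with h0 | hn₃
  · rw [Finset.sum_eq_zero (hdeg (Or.inr h0))]; exact dvd_zero _
  rw [show ((p : ℤ) ^ (3 * r)) = ((p ^ (3 * r) : ℕ) : ℤ) by push_cast; rfl]
  rw [show ((p ^ (3 * r) : ℕ) : ℤ) = (p ^ (3 * r) : ℤ) by push_cast; rfl, ← PadicInt.pow_p_dvd_int_iff]
  push_cast
  have hterm : ∀ k ∈ range (p ^ r * n₁ + 1),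
      (if p ∣ k then (0 : ℤ_[p]) else
        ((((p ^ r * n₁).choose k : ℕ) : ℤ_[p]) * (((p ^ r * n₁ + p ^ r * n₂ - k).choose (p ^ r * n₁) : ℕ) : ℤ_[p]) *
          (((p ^ r * n₃).choose k : ℕ) : ℤ_[p]))) =
      ((p : ℤ_[p]) ^ (2 * r) * (n₁ * n₃ : ℕ)) * ((Ring.inverse ((k : ℤ_[p]))) ^ 2 *
        (((p ^ r * n₁ - 1).choose (k - 1) * (p ^ r * n₁ + p ^ r * n₂ - k).choose (p ^ r * n₁) *
          (p ^ r * n₃ - 1).choose (k - 1) : ℕ) : ℤ_[p])) := by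
    intro k _
    split_ifs with hk
    · rw [ringInverse_natCast_of_dvd' hk, zero_pow two_ne_zero, zero_mul, mul_zero]
    · have hk1 : 1 ≤ k := Nat.one_le_iff_ne_zero.mpr fun h => hk (h ▸ dvd_zero p)
      have hid := sq_mul_termB_eq (m₁ := p ^ r * n₁) (m₂ := p ^ r * n₂) (m₃ := p ^ r * n₃) hk1
      have hinv := ringInverse_natCast_mul_self' (p := p) hk
      have hcast := congrArg (Nat.cast : ℕ → ℤ_[p]) hid
      push_cast at hcast ⊢
      calc _ = (Ring.inverse ((k : ℤ_[p])) * (k : ℤ_[p])) ^ 2 *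
            (((p ^ r * n₁).choose k : ℤ_[p]) * ((p ^ r * n₁ + p ^ r * n₂ - k).choose (p ^ r * n₁) : ℤ_[p]) *
              ((p ^ r * n₃).choose k : ℤ_[p])) := by rw [hinv, one_pow, one_mul]
        _ = (Ring.inverse ((k : ℤ_[p]))) ^ 2 * ((k : ℤ_[p]) ^ 2 *
            (((p ^ r * n₁).choose k : ℤ_[p]) * ((p ^ r * n₁ + p ^ r * n₂ - k).choose (p ^ r * n₁) : ℤ_[p]) *
              ((p ^ r * n₃).choose k : ℤ_[p]))) := by ring
        _ = _ := by rw [hcast]; ring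
  rw [Finset.sum_congr rfl hterm, ← Finset.mul_sum, show 3 * r = 2 * r + r by ring, pow_add, mul_assoc]
  refine mul_dvd_mul_left _ (Dvd.dvd.mul_left ?_ _)
  have hC1 : (p : ℤ_[p]) ^ r ∣ ∑ k ∈ range (p ^ r * n₁ + 1), ((Ring.inverse ((k : ℤ_[p]))) ^ 2 *
        (((p ^ r * n₁ - 1).choose (k - 1) * (p ^ r * n₁ + p ^ r * n₂ - k).choose (p ^ r * n₁) *
          (p ^ r * n₃ - 1).choose (k - 1) : ℕ) : ℤ_[p]) -
      (Ring.inverse ((k : ℤ_[p]))) ^ 2 *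
        (((p ^ r * n₁ - 1).choose k * (p ^ r * n₁ + p ^ r * n₂ - k - 1).choose (p ^ r * n₁) *
          (p ^ r * n₃ - 1).choose k : ℕ) : ℤ_[p])) := by
    refine Finset.dvd_sum fun k _ => ?_
    by_cases hk : p ∣ k
    · rw [ringInverse_natCast_of_dvd' hk, zero_pow two_ne_zero, zero_mul, zero_mul, sub_self]
      exact dvd_zero _
    · have hk1 : 1 ≤ k := Nat.one_le_iff_ne_zero.mpr fun h => hk (h ▸ dvd_zero p)
      rw [← mul_sub]
      refine Dvd.dvd.mul_left ?_ _
      have e1 : p ^ r * n₁ + p ^ r * n₂ - k = p ^ r * n₁ + p ^ r * n₂ - (k - 1) - 1 := by omega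
      have hA := companionB_modEq hp' hr hn₁ hn₃ n₂ (k - 1)
      have hB := companionB_modEq hp' hr hn₁ hn₃ n₂ k
      rw [sub_one_div_eq hk1 hk] at hA
      obtain ⟨c, hc⟩ := Int.ModEq.dvd ((hA.trans hB.symm).symm)
      refine ⟨(c : ℤ_[p]), ?_⟩
      have := congrArg (Int.cast : ℤ → ℤ_[p]) hc
      push_cast at this ⊢
      rw [← e1] at this
      linear_combination this
  have hC2 : (p : ℤ_[p]) ^ r ∣ ∑ k ∈ range (p ^ r * n₁ + 1), (Ring.inverse ((k : ℤ_[p]))) ^ 2 *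
        (((p ^ r * n₁ - 1).choose k * (p ^ r * n₁ + p ^ r * n₂ - k - 1).choose (p ^ r * n₁) *
          (p ^ r * n₃ - 1).choose k : ℕ) : ℤ_[p]) := by
    have hpN : p ∣ p ^ r * n₁ := Dvd.dvd.mul_right (dvd_pow_self p (by omega)) n₁
    rw [Finset.sum_range_succ, ringInverse_natCast_of_dvd' hpN, zero_pow two_ne_zero, zero_mul, add_zero]
    have hW := pow_dvd_sum_weights_companionB (p := p) h5 r hn₁ hn₃ n₂
    rwa [mul_comm n₁ (p ^ r)] at hW
  have := dvd_add hC1 hC2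
  rw [← Finset.sum_add_distrib] at this
  simpa using this

end GZeroB

end Literature.Combinatorics.Enumerative.MultivariateAperyPrimePowerProofs
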